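import Summits.ResolutionOfSingularities.ResolutionOfSingularities.Theorems.WildPurityPurityTransfer
import Summits.ResolutionOfSingularities.ResolutionOfSingularities.Theorems.WildPurityPurityTransferStubPurityTransport
import Summits.ResolutionOfSingularities.ResolutionOfSingularities.Theorems.WildPurityPurityTransferBlochKatoPresentation
import Literature.NumberTheory.GaloisCohomology.KatoCohomologyPurityDeRham
import HarnessLib

/-!
# Crux `WildPurity.PurityTransfer` conditional on Gros–Suwa purity ON DIFFERENTIAL FORMS only
# (stmt-ResolutionOfSingularities-17142, line `birth`, lead c1)

Lead 0 landed `PurityTransfer_of_grosSuwa1988 : GrosSuwa1988_purity.{0} → PurityTransfer`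
(`Theorems/WildPurityPurityTransfer.lean`), the crux conditional on Gersten purity for Kato's `H^{n+1}_p` in
the SYMBOLIC presentation.  Lead c1 split that fact along its only discharge road and landed the provable
half: the Bloch–Kato presentation `KatoCohomologySymbolic ≃+ KatoCohomologyDeRham` is now a theorem
(`BlochKato1986_symbolicPresentation_holds`, `Theorems/WildPurityPurityTransferBlochKatoPresentation.lean`,
from `Literature/…/BlochKatoForms.lean`, `…/BlochKatoFormsSymbol.lean` and the stubs `stub_formsSpan`,
`stub_bkForward`, `stub_bkDescends`, `stub_bkAssemble`), and the transport `stub_purityTransport`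
(`Theorems/WildPurityPurityTransferStubPurityTransport.lean`) turns purity ON FORMS into the symbolic fact.

Hence the two theorems of this file:

* `grosSuwa1988_purity_of_deRham : GrosSuwa1988_purity_deRham → GrosSuwa1988_purity` — the symbolic
  named fact is DERIVED from the de Rham-side one (`Literature/…/KatoCohomologyPurityDeRham.lean`);
* `PurityTransfer_of_deRhamPurity : GrosSuwa1988_purity_deRham.{0} → PurityTransfer` — the crux conditional
  on exactly the part of [GrosSuwa1988, Thm. 1.4] that needs the inverse Cartier operator and the
  Cousin-complex argument on the local ring of a smooth scheme (not in Mathlib), and on nothing else.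

When `GrosSuwa1988_purity_deRham` is discharged, `PurityTransfer` follows by one application (append here,
`--workitem stmt-ResolutionOfSingularities-17142`).
-/

set_option linter.dupNamespace false

noncomputable section

universe u

open Literature.NumberTheory.GaloisCohomology
open Summit.ResolutionOfSingularities.ResolutionOfSingularities.Theses.WildPurity (PurityTransfer)

namespace Summit.ResolutionOfSingularities.ResolutionOfSingularities.Theorems.WildPurityPurityTransfer

/-- **The symbolic Gros–Suwa purity fact follows from the de Rham-side one**: transport along the
Bloch–Kato isomorphism (`stub_purityTransport`), which is now unconditional
(`BlochKato1986_symbolicPresentation_holds`). [cite: GrosSuwa1988, Thm. 1.4; BlochKato1986, Lemma (4.2)] -/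
theorem grosSuwa1988_purity_of_deRham (h : GrosSuwa1988_purity_deRham.{u}) : GrosSuwa1988_purity.{u} :=
  stub_purityTransport.{u} BlochKato1986_symbolicPresentation_holds.{u} h

/-- **The crux `PurityTransfer` conditional on Gros–Suwa purity on differential forms only**
(`GrosSuwa1988_purity_deRham`, universe `0`): Kato valuative purity above a resolvable affine model —
valuative-criterion lift to the regular model, regular chart inside `O`, Gersten purity at the centre
(symbolic form derived from the de Rham form through the Bloch–Kato presentation), local domination.
[cite: GrosSuwa1988, Thm. 1.4; BlochKato1986, Lemma (4.2); ZariskiSamuel1960, Ch. VI §14, Thm. 31] -/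
theorem PurityTransfer_of_deRhamPurity (h : GrosSuwa1988_purity_deRham.{0}) : PurityTransfer :=
  PurityTransfer_of_grosSuwa1988 (grosSuwa1988_purity_of_deRham.{0} h)

end Summit.ResolutionOfSingularities.ResolutionOfSingularities.Theorems.WildPurityPurityTransfer

end
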